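import Summits.Ventures.PercRepro.RankLevelSetPerElemThreeSkel

/-! # RankLevelSetPerElemThreeCount — THE SKELETON OF (★★) AT LEVEL `3`, PART 2: THE DOUBLE COUNT OF THE
MEMBERS WHOSE CIRCUIT WITH `y` IS A TRIANGLE, AND THE SKELETON THEOREM (night-1 g35; dossier §47.9; on
`RankLevelSetPerElemThreeSkel`)

A member `Z` whose circuit with `y` is the triangle `C = S + y` is `Z = S ∪ {c}` (`exists_sdiff_fundCircuit_eq_singleton`);
it is adjacent to the bi-independent `4`-sets `Q` through `y` with `c ∈ Q` and `S ⊆ E ∖ Q`. Every such `Q` is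
adjacent to at most three members (`c ∈ Q ∖ {y}`, `S` forced by the circuit of `y` in `E ∖ Q`), and — the
hypothesis `hB`, the three good pairs of dossier §47.9 — every member to at least three, so
`3 · #members ≤ #pairs ≤ 3 · #targets` (`absorb_three_le`, with `Finset.mul_card_image_le_card_of_maps_to` and
`Finset.card_le_mul_card_image_of_maps_to` on the pair set). THEOREM (**`perElemAt_three_of_exists`**): for `y`
without a parallel partner and `8 ≤ #E`, the through-quadruples (`hA`) and the three good pairs (`hB`) give
`#{Z ∈ D_3 : y ∉ Z} ≤ #{Q ∈ D_4 : y ∈ Q}` — the left side is the disjoint union of the free sets and the two kinds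
of absorbing sets, the right side contains the disjoint union of their images (`free_three_le`, `absorb_four_le`,
`absorb_three_le`). With `RankLevelSetPerElemReduce` (`perElemAt_three_of_simple`), the two hypotheses for simple
coloop-free matroids — proved on paper in dossier §47.9, the declared residue — give (★★) at level `3` for every
finite matroid. Every declaration has a docstring; imports: the cell's own modules and Mathlib only. Axioms:
standard. -/

namespace PercRepro

open Set Matroid

variable {α : Type} (M : Matroid α) [M.Finite]

/-! ## The members whose circuit with `y` is a triangle -/

omit [M.Finite] in
/-- For an absorbing `3`-set whose circuit with `y` is a triangle, `Z ∖ C` is a single element `c`: the circuit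
`C ⊆ insert y Z` meets `Z` in `C ∖ {y}`, two elements. -/
lemma exists_sdiff_fundCircuit_eq_singleton {y : α} (hy : y ∈ M.E) {Z : Set α} (hZ : Z ∈ lowAbsorbAt M y 3)
    (h3 : (M.fundCircuit y Z).ncard = 3) : ∃ c, Z \ M.fundCircuit y Z = {c} := by
  have hycl := mem_closure_of_mem_lowAbsorbAt' M hy hZ
  obtain ⟨⟨hZE, hZ3, hZi, -⟩, hyZ, -⟩ := hZ
  have hZfin : Z.Finite := Set.finite_of_ncard_pos (by omega)
  have hsub : M.fundCircuit y Z ⊆ insert y Z := M.fundCircuit_subset_insert y Z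
  have hyC : y ∈ M.fundCircuit y Z := M.mem_fundCircuit y Z
  have hCfin : (M.fundCircuit y Z).Finite := (hZfin.insert y).subset hsub
  have hCZ : M.fundCircuit y Z \ {y} ⊆ Z := by
    intro x hx
    rcases hsub hx.1 with h | h
    · exact absurd h hx.2
    · exact h
  have h2 : (M.fundCircuit y Z \ {y}).ncard = 2 := by
    rw [Set.ncard_sdiff_singleton_of_mem hyC, h3]
  have hinter : Z ∩ M.fundCircuit y Z = M.fundCircuit y Z \ {y} := by
    ext x
    simp only [Set.mem_inter_iff, Set.mem_sdiff, Set.mem_singleton_iff]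
    constructor
    · rintro ⟨hxZ, hxC⟩
      exact ⟨hxC, fun h => hyZ (h ▸ hxZ)⟩
    · rintro ⟨hxC, hxy⟩
      exact ⟨hCZ ⟨hxC, hxy⟩, hxC⟩
  have h1 : (Z \ M.fundCircuit y Z).ncard = 1 := by
    have := Set.ncard_inter_add_ncard_sdiff_eq_ncard Z (M.fundCircuit y Z) hZfin
    rw [hinter, h2, hZ3] at this
    omega
  exact Set.ncard_eq_one.mp h1

/-- **The absorbing `3`-sets whose circuit with `y` is a triangle are at most as many as the bi-independent
`4`-sets through `y` whose complement spans `y` with a triangle**, given three good pairs for each such member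
(`hB`): the member `Z = S ∪ {c}` (`S = C ∖ {y}`) is adjacent to `Q` when `c ∈ Q` and `S ⊆ E ∖ Q`; each member has
at least three neighbours and each `Q` at most three (`c ∈ Q ∖ {y}`, `S` forced by the circuit of `y` in
`E ∖ Q`), so `3 · #members ≤ #pairs ≤ 3 · #targets`. -/
lemma absorb_three_le {y : α} (hy : y ∈ M.E)
    (hB : ∀ Z ∈ lowAbsorbAt M y 3, (M.fundCircuit y Z).ncard = 3 → ∀ c, Z \ M.fundCircuit y Z = {c} →
      3 ≤ {T | T ⊆ M.E \ insert y Z ∧ T.ncard = 2 ∧ insert y (insert c T) ∈ biIndep M 4}.ncard) :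
    {Z ∈ lowAbsorbAt M y 3 | (M.fundCircuit y Z).ncard = 3}.ncard ≤
      {Q ∈ biIndep M 4 | y ∈ Q ∧ ¬ M.Indep (insert y (M.E \ Q)) ∧
        (M.fundCircuit y (M.E \ Q)).ncard = 3}.ncard := by
  classical
  have hAfin : {Z ∈ lowAbsorbAt M y 3 | (M.fundCircuit y Z).ncard = 3}.Finite :=
    (lowAbsorbAt_finite M y 3).subset (fun Z hZ => hZ.1)
  have hBfin : {Q ∈ biIndep M 4 | y ∈ Q ∧ ¬ M.Indep (insert y (M.E \ Q)) ∧
      (M.fundCircuit y (M.E \ Q)).ncard = 3}.Finite :=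
    (biIndep_finite M 4).subset (fun Q hQ => hQ.1)
  -- the pairs `(Z, Q)` with `Z ∖ C ⊆ Q` and `C ∖ {y} ⊆ E ∖ Q`
  set P : Finset (Set α × Set α) := (hAfin.toFinset ×ˢ hBfin.toFinset).filter
    (fun p => (p.1 \ M.fundCircuit y p.1) ⊆ p.2 ∧ (M.fundCircuit y p.1 \ {y}) ⊆ M.E \ p.2) with hPdef
  -- the fibre of `Z` is the set of its neighbours
  have hfib1 : ∀ Z ∈ hAfin.toFinset, {p ∈ P | p.1 = Z}.card =
      (hBfin.toFinset.filter (fun Q => (Z \ M.fundCircuit y Z) ⊆ Q ∧ (M.fundCircuit y Z \ {y}) ⊆ M.E \ Q)).card := by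
    intro Z hZ
    refine Finset.card_bij (fun p _ => p.2) ?_ ?_ ?_
    · intro p hp
      rw [Finset.mem_filter] at hp ⊢
      obtain ⟨hpP, hp1⟩ := hp
      rw [hPdef, Finset.mem_filter, Finset.mem_product] at hpP
      rw [hp1] at hpP
      exact ⟨hpP.1.2, hpP.2⟩
    · intro p₁ hp₁ p₂ hp₂ heq
      rw [Finset.mem_filter] at hp₁ hp₂
      exact Prod.ext (hp₁.2.trans hp₂.2.symm) heq
    · intro Q hQ
      rw [Finset.mem_filter] at hQ
      refine ⟨(Z, Q), ?_, rfl⟩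
      rw [Finset.mem_filter, hPdef, Finset.mem_filter, Finset.mem_product]
      exact ⟨⟨⟨hZ, hQ.1⟩, hQ.2⟩, rfl⟩
  have hfib2 : ∀ Q ∈ hBfin.toFinset, {p ∈ P | p.2 = Q}.card =
      (hAfin.toFinset.filter (fun Z => (Z \ M.fundCircuit y Z) ⊆ Q ∧ (M.fundCircuit y Z \ {y}) ⊆ M.E \ Q)).card := by
    intro Q hQ
    refine Finset.card_bij (fun p _ => p.1) ?_ ?_ ?_
    · intro p hp
      rw [Finset.mem_filter] at hp ⊢
      obtain ⟨hpP, hp2⟩ := hp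
      rw [hPdef, Finset.mem_filter, Finset.mem_product] at hpP
      rw [hp2] at hpP
      exact ⟨hpP.1.1, hpP.2⟩
    · intro p₁ hp₁ p₂ hp₂ heq
      rw [Finset.mem_filter] at hp₁ hp₂
      exact Prod.ext heq (hp₁.2.trans hp₂.2.symm)
    · intro Z hZ
      rw [Finset.mem_filter] at hZ
      refine ⟨(Z, Q), ?_, rfl⟩
      rw [Finset.mem_filter, hPdef, Finset.mem_filter, Finset.mem_product]
      exact ⟨⟨⟨hZ.1, hQ⟩, hZ.2⟩, rfl⟩
  -- LOWER BOUND: every member has at least three neighbours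
  have hlow : 3 * hAfin.toFinset.card ≤ P.card := by
    refine Finset.mul_card_image_le_card_of_maps_to (f := Prod.fst) ?_ 3 ?_
    · intro p hp
      rw [hPdef, Finset.mem_filter, Finset.mem_product] at hp
      exact hp.1.1
    · intro Z hZ
      rw [hfib1 Z hZ]
      have hZA := hAfin.mem_toFinset.mp hZ
      obtain ⟨hZabs, h3⟩ := hZA
      obtain ⟨c, hc⟩ := exists_sdiff_fundCircuit_eq_singleton M hy hZabs h3
      have hB' := hB Z hZabs h3 c hc
      -- the map `T ↦ insert y (insert c T)` from the good pairs into the neighbours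
      have hycl := mem_closure_of_mem_lowAbsorbAt' M hy hZabs
      obtain ⟨⟨hZE, hZ3, hZi, hcind⟩, hyZ, hdep⟩ := hZabs
      have hC : M.IsCircuit (M.fundCircuit y Z) := hZi.fundCircuit_isCircuit hycl hyZ
      have hyC : y ∈ M.fundCircuit y Z := M.mem_fundCircuit y Z
      have hsub : M.fundCircuit y Z ⊆ insert y Z := M.fundCircuit_subset_insert y Z
      have hcZ : c ∈ Z := by
        have : c ∈ Z \ M.fundCircuit y Z := by rw [hc]; exact Set.mem_singleton c
        exact this.1
      have hcC : c ∉ M.fundCircuit y Z := by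
        have : c ∈ Z \ M.fundCircuit y Z := by rw [hc]; exact Set.mem_singleton c
        exact this.2
      have hcy : c ≠ y := fun h => hyZ (h ▸ hcZ)
      have hSZ : M.fundCircuit y Z \ {y} ⊆ Z := by
        intro x hx
        rcases hsub hx.1 with h | h
        · exact absurd h hx.2
        · exact h
      have hCeq : insert y (M.fundCircuit y Z \ {y}) = M.fundCircuit y Z := by
        rw [Set.insert_sdiff_singleton, Set.insert_eq_of_mem hyC]
      have hmaps : ∀ T ∈ {T | T ⊆ M.E \ insert y Z ∧ T.ncard = 2 ∧ insert y (insert c T) ∈ biIndep M 4},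
          insert y (insert c T) ∈ (hBfin.toFinset.filter
            (fun Q => (Z \ M.fundCircuit y Z) ⊆ Q ∧ (M.fundCircuit y Z \ {y}) ⊆ M.E \ Q) : Set (Set α)) := by
        rintro T ⟨hTJ, -, hTb⟩
        have hSQ : M.fundCircuit y Z \ {y} ⊆ M.E \ insert y (insert c T) := by
          intro x hx
          have hxZ := hSZ hx
          refine ⟨hZE hxZ, ?_⟩
          simp only [Set.mem_insert_iff, not_or]
          refine ⟨fun h => hyZ (h ▸ hxZ), fun h => hcC (h ▸ hx.1), fun h => (hTJ h).2 (Set.mem_insert_of_mem y hxZ)⟩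
        have hCsub : M.fundCircuit y Z ⊆ insert y (M.E \ insert y (insert c T)) := by
          rw [← hCeq]; exact Set.insert_subset_insert hSQ
        have hfund : M.fundCircuit y (M.E \ insert y (insert c T)) = M.fundCircuit y Z :=
          (eq_fundCircuit_compl M hTb hC hCsub).symm
        rw [Finset.coe_filter, Set.mem_setOf_eq, hBfin.mem_toFinset]
        refine ⟨⟨hTb, Set.mem_insert y _, fun hind => hC.not_indep (hind.subset hCsub), by rw [hfund, h3]⟩,
          ?_, hSQ⟩
        rw [hc]
        exact Set.singleton_subset_iff.mpr (Set.mem_insert_of_mem y (Set.mem_insert c T))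
      have hinj : Set.InjOn (fun T => insert y (insert c T))
          {T | T ⊆ M.E \ insert y Z ∧ T.ncard = 2 ∧ insert y (insert c T) ∈ biIndep M 4} := by
        rintro T₁ ⟨hT₁, -, -⟩ T₂ ⟨hT₂, -, -⟩ heq
        have heq' : insert y (insert c T₁) = insert y (insert c T₂) := heq
        have hyT : ∀ {T : Set α}, T ⊆ M.E \ insert y Z → y ∉ insert c T := by
          intro T hT h
          rcases h with h | h
          · exact hcy h.symm
          · exact (hT h).2 (Set.mem_insert y Z)
        have hcT : ∀ {T : Set α}, T ⊆ M.E \ insert y Z → c ∉ T := by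
          intro T hT h
          exact (hT h).2 (Set.mem_insert_of_mem y hcZ)
        have h1 : insert c T₁ = insert c T₂ := by
          have := congrArg (fun S => S \ {y}) heq'
          simpa only [Set.insert_sdiff_of_mem _ (Set.mem_singleton y), Set.sdiff_singleton_eq_self (hyT hT₁),
            Set.sdiff_singleton_eq_self (hyT hT₂)] using this
        have := congrArg (fun S => S \ {c}) h1
        simpa only [Set.insert_sdiff_of_mem _ (Set.mem_singleton c), Set.sdiff_singleton_eq_self (hcT hT₁),
          Set.sdiff_singleton_eq_self (hcT hT₂)] using this
      have hle := Set.ncard_le_ncard_of_injOn _ hmaps hinj (Finset.finite_toSet _)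
      rw [Set.ncard_coe_finset] at hle
      omega
  -- UPPER BOUND: every target has at most three neighbours
  have hup : P.card ≤ 3 * hBfin.toFinset.card := by
    refine Finset.card_le_mul_card_image_of_maps_to (f := Prod.snd) ?_ 3 ?_
    · intro p hp
      rw [hPdef, Finset.mem_filter, Finset.mem_product] at hp
      exact hp.1.2
    · intro Q hQ
      rw [hfib2 Q hQ]
      have hQB := hBfin.mem_toFinset.mp hQ
      obtain ⟨⟨hQE, hQ4, hQi, hcind⟩, hyQ, hdepQ, h3Q⟩ := hQB
      have hQfin : Q.Finite := M.ground_finite.subset hQE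
      -- the neighbours of `Q` inject into `Q ∖ {y}` by `Z ↦ c`
      have hmaps : ∀ Z ∈ (hAfin.toFinset.filter
          (fun Z => (Z \ M.fundCircuit y Z) ⊆ Q ∧ (M.fundCircuit y Z \ {y}) ⊆ M.E \ Q) : Set (Set α)),
          ∃ c, Z \ M.fundCircuit y Z = {c} := by
        intro Z hZ
        rw [Finset.coe_filter, Set.mem_setOf_eq, hAfin.mem_toFinset] at hZ
        exact exists_sdiff_fundCircuit_eq_singleton M hy hZ.1.1 hZ.1.2
      obtain ⟨cof, hcof⟩ : ∃ cof : Set α → α, ∀ Z ∈ (hAfin.toFinset.filter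
          (fun Z => (Z \ M.fundCircuit y Z) ⊆ Q ∧ (M.fundCircuit y Z \ {y}) ⊆ M.E \ Q) : Set (Set α)),
          Z \ M.fundCircuit y Z = {cof Z} := by
        refine ⟨fun Z => if h : ∃ c, Z \ M.fundCircuit y Z = {c} then h.choose else y, ?_⟩
        intro Z hZ
        have h := hmaps Z hZ
        simp only [dif_pos h]
        exact h.choose_spec
      have hcmaps : ∀ Z ∈ (hAfin.toFinset.filter
          (fun Z => (Z \ M.fundCircuit y Z) ⊆ Q ∧ (M.fundCircuit y Z \ {y}) ⊆ M.E \ Q) : Set (Set α)),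
          cof Z ∈ Q \ {y} := by
        intro Z hZ
        have hc := hcof Z hZ
        rw [Finset.coe_filter, Set.mem_setOf_eq, hAfin.mem_toFinset] at hZ
        have hmem : cof Z ∈ Z \ M.fundCircuit y Z := by rw [hc]; exact Set.mem_singleton _
        refine ⟨hZ.2.1 hmem, ?_⟩
        rw [Set.mem_singleton_iff]
        exact fun h => hZ.1.1.2.1 (h ▸ hmem.1)
      have hcinj : Set.InjOn cof (hAfin.toFinset.filter
          (fun Z => (Z \ M.fundCircuit y Z) ⊆ Q ∧ (M.fundCircuit y Z \ {y}) ⊆ M.E \ Q) : Set (Set α)) := by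
        intro Z₁ hZ₁ Z₂ hZ₂ heq
        have hc₁ := hcof Z₁ hZ₁
        have hc₂ := hcof Z₂ hZ₂
        rw [Finset.coe_filter, Set.mem_setOf_eq, hAfin.mem_toFinset] at hZ₁ hZ₂
        -- both circuits are the circuit of `y` in `E ∖ Q`
        have hcirc : ∀ {Z : Set α}, Z ∈ lowAbsorbAt M y 3 → (M.fundCircuit y Z \ {y}) ⊆ M.E \ Q →
            M.fundCircuit y Z = M.fundCircuit y (M.E \ Q) := by
          intro Z hZ hS
          have hycl := mem_closure_of_mem_lowAbsorbAt' M hy hZ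
          have hC : M.IsCircuit (M.fundCircuit y Z) := hZ.1.2.2.1.fundCircuit_isCircuit hycl hZ.2.1
          have hyC : y ∈ M.fundCircuit y Z := M.mem_fundCircuit y Z
          refine eq_fundCircuit_compl M ⟨hQE, hQ4, hQi, hcind⟩ hC ?_
          intro x hx
          by_cases hxy : x = y
          · rw [hxy]; exact Set.mem_insert y _
          · exact Set.mem_insert_of_mem y (hS ⟨hx, hxy⟩)
        have hC₁ := hcirc hZ₁.1.1 hZ₁.2.2
        have hC₂ := hcirc hZ₂.1.1 hZ₂.2.2
        -- `Z = (C ∖ {y}) ∪ {c}`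
        have hdecomp : ∀ {Z : Set α}, Z ∈ lowAbsorbAt M y 3 → ∀ {c : α}, Z \ M.fundCircuit y Z = {c} →
            Z = (M.fundCircuit y Z \ {y}) ∪ {c} := by
          intro Z hZ c hc
          have hsub : M.fundCircuit y Z ⊆ insert y Z := M.fundCircuit_subset_insert y Z
          ext x
          simp only [Set.mem_union, Set.mem_sdiff, Set.mem_singleton_iff]
          constructor
          · intro hxZ
            by_cases hxC : x ∈ M.fundCircuit y Z
            · exact Or.inl ⟨hxC, fun h => hZ.2.1 (h ▸ hxZ)⟩
            · right
              have : x ∈ Z \ M.fundCircuit y Z := ⟨hxZ, hxC⟩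
              rw [hc] at this
              exact this
          · rintro (⟨hxC, hxy⟩ | rfl)
            · rcases hsub hxC with h | h
              · exact absurd h hxy
              · exact h
            · have : x ∈ Z \ M.fundCircuit y Z := by rw [hc]; exact Set.mem_singleton x
              exact this.1
        rw [hdecomp hZ₁.1.1 hc₁, hdecomp hZ₂.1.1 hc₂, hC₁, hC₂, heq]
      have hle := Set.ncard_le_ncard_of_injOn cof hcmaps hcinj (hQfin.subset Set.sdiff_subset)
      rw [Set.ncard_coe_finset, Set.ncard_sdiff_singleton_of_mem hyQ, hQ4] at hle
      exact hle
  rw [Set.ncard_eq_toFinset_card _ hAfin, Set.ncard_eq_toFinset_card _ hBfin]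
  omega

/-! ## The skeleton theorem -/

/-- **THE SKELETON OF (★★) AT LEVEL `3`**: for `y ∈ E` without a parallel partner and `8 ≤ #E`, if every absorbing
`3`-set whose circuit with `y` has four elements has a through-quadruple (`hA`) and every absorbing `3`-set
`Z = S ∪ {c}` whose circuit with `y` is the triangle `S + y` has at least three good pairs (`hB`), then
`#{Z ∈ D_3 : y ∉ Z} ≤ #{Q ∈ D_4 : y ∈ Q}`. The left side is the disjoint union of the free sets and the two kinds
of absorbing sets; the right side contains the disjoint union of their three images (`free_three_le`,
`absorb_four_le`, `absorb_three_le`). -/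
theorem perElemAt_three_of_exists {y : α} (hy : y ∈ M.E) (hnp : ∀ z, z ≠ y → y ∉ M.closure {z})
    (hn : 8 ≤ M.E.ncard)
    (hA : ∀ Z ∈ lowAbsorbAt M y 3, (M.fundCircuit y Z).ncard = 4 →
      ∃ T, T ⊆ M.E \ insert y Z ∧ T.ncard = 3 ∧ insert y T ∈ biIndep M 4)
    (hB : ∀ Z ∈ lowAbsorbAt M y 3, (M.fundCircuit y Z).ncard = 3 → ∀ c, Z \ M.fundCircuit y Z = {c} →
      3 ≤ {T | T ⊆ M.E \ insert y Z ∧ T.ncard = 2 ∧ insert y (insert c T) ∈ biIndep M 4}.ncard) :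
    {Z ∈ biIndep M 3 | y ∉ Z}.ncard ≤ {Q ∈ biIndep M 4 | y ∈ Q}.ncard := by
  -- a second element of the ground set
  obtain ⟨z₀, hz₀⟩ : (M.E \ {y}).Nonempty := by
    rw [← Set.ncard_pos (M.ground_finite.subset Set.sdiff_subset), Set.ncard_sdiff_singleton_of_mem hy]
    omega
  have hz₀y : z₀ ≠ y := by simpa using hz₀.2
  -- the left side splits
  have hL : {Z ∈ biIndep M 3 | y ∉ Z} = {Z ∈ biIndep M 3 | y ∉ Z ∧ M.Indep (insert y Z)} ∪
      ({Z ∈ lowAbsorbAt M y 3 | (M.fundCircuit y Z).ncard = 4} ∪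
        {Z ∈ lowAbsorbAt M y 3 | (M.fundCircuit y Z).ncard = 3}) := by
    ext Z
    simp only [Set.mem_setOf_eq, Set.mem_union]
    constructor
    · rintro ⟨hZ, hyZ⟩
      by_cases hind : M.Indep (insert y Z)
      · exact Or.inl ⟨hZ, hyZ, hind⟩
      · have hZabs : Z ∈ lowAbsorbAt M y 3 := ⟨hZ, hyZ, hind⟩
        obtain ⟨h3, h4⟩ := fundCircuit_ncard_absorb M hy hnp hz₀y hZabs
        rcases Nat.lt_or_ge (M.fundCircuit y Z).ncard 4 with hlt | hge
        · exact Or.inr (Or.inr ⟨hZabs, by omega⟩)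
        · exact Or.inr (Or.inl ⟨hZabs, by omega⟩)
    · rintro (⟨hZ, hyZ, -⟩ | ⟨⟨hZ, hyZ, -⟩, -⟩ | ⟨⟨hZ, hyZ, -⟩, -⟩) <;> exact ⟨hZ, hyZ⟩
  have hd1 : Disjoint {Z ∈ biIndep M 3 | y ∉ Z ∧ M.Indep (insert y Z)}
      ({Z ∈ lowAbsorbAt M y 3 | (M.fundCircuit y Z).ncard = 4} ∪
        {Z ∈ lowAbsorbAt M y 3 | (M.fundCircuit y Z).ncard = 3}) := by
    rw [Set.disjoint_left]
    rintro Z ⟨-, -, hind⟩ (⟨⟨-, -, hdep⟩, -⟩ | ⟨⟨-, -, hdep⟩, -⟩) <;> exact hdep hind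
  have hd2 : Disjoint {Z ∈ lowAbsorbAt M y 3 | (M.fundCircuit y Z).ncard = 4}
      {Z ∈ lowAbsorbAt M y 3 | (M.fundCircuit y Z).ncard = 3} := by
    rw [Set.disjoint_left]
    rintro Z ⟨-, h4⟩ ⟨-, h3⟩
    omega
  have hfin3 : ∀ S : Set (Set α), S ⊆ biIndep M 3 → S.Finite := fun S hS => (biIndep_finite M 3).subset hS
  have hfin4 : ∀ S : Set (Set α), S ⊆ biIndep M 4 → S.Finite := fun S hS => (biIndep_finite M 4).subset hS
  rw [hL, Set.ncard_union_eq hd1 (hfin3 _ (fun Z hZ => hZ.1))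
      (hfin3 _ (fun Z hZ => by rcases hZ with hZ | hZ <;> exact hZ.1.1)),
    Set.ncard_union_eq hd2 (hfin3 _ (fun Z hZ => hZ.1.1)) (hfin3 _ (fun Z hZ => hZ.1.1))]
  -- the right side contains the three images
  have hsub : {Q ∈ biIndep M 4 | y ∈ Q ∧ M.Indep (insert y (M.E \ Q))} ∪
      ({Q ∈ biIndep M 4 | y ∈ Q ∧ ¬ M.Indep (insert y (M.E \ Q)) ∧ (M.fundCircuit y (M.E \ Q)).ncard = 4} ∪
        {Q ∈ biIndep M 4 | y ∈ Q ∧ ¬ M.Indep (insert y (M.E \ Q)) ∧ (M.fundCircuit y (M.E \ Q)).ncard = 3}) ⊆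
      {Q ∈ biIndep M 4 | y ∈ Q} := by
    rintro Q (⟨hQ, hyQ, -⟩ | ⟨hQ, hyQ, -⟩ | ⟨hQ, hyQ, -⟩) <;> exact ⟨hQ, hyQ⟩
  have he1 : Disjoint {Q ∈ biIndep M 4 | y ∈ Q ∧ M.Indep (insert y (M.E \ Q))}
      ({Q ∈ biIndep M 4 | y ∈ Q ∧ ¬ M.Indep (insert y (M.E \ Q)) ∧ (M.fundCircuit y (M.E \ Q)).ncard = 4} ∪
        {Q ∈ biIndep M 4 | y ∈ Q ∧ ¬ M.Indep (insert y (M.E \ Q)) ∧ (M.fundCircuit y (M.E \ Q)).ncard = 3}) := by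
    rw [Set.disjoint_left]
    rintro Q ⟨-, -, hind⟩ (⟨-, -, hdep, -⟩ | ⟨-, -, hdep, -⟩) <;> exact hdep hind
  have he2 : Disjoint
      {Q ∈ biIndep M 4 | y ∈ Q ∧ ¬ M.Indep (insert y (M.E \ Q)) ∧ (M.fundCircuit y (M.E \ Q)).ncard = 4}
      {Q ∈ biIndep M 4 | y ∈ Q ∧ ¬ M.Indep (insert y (M.E \ Q)) ∧ (M.fundCircuit y (M.E \ Q)).ncard = 3} := by
    rw [Set.disjoint_left]
    rintro Q ⟨-, -, -, h4⟩ ⟨-, -, -, h3⟩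
    omega
  have hR := Set.ncard_le_ncard hsub (hfin4 _ (fun Q hQ => hQ.1))
  rw [Set.ncard_union_eq he1 (hfin4 _ (fun Q hQ => hQ.1))
      (hfin4 _ (fun Q hQ => by rcases hQ with hQ | hQ <;> exact hQ.1)),
    Set.ncard_union_eq he2 (hfin4 _ (fun Q hQ => hQ.1)) (hfin4 _ (fun Q hQ => hQ.1))] at hR
  have h1 := free_three_le M hy
  have h2 := absorb_four_le M hy hA
  have h3 := absorb_three_le M hy hB
  omega

end PercRepro
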